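import Mathlib
import Literature.Algebra.EuclideanLattices.FccBccLattices

/-!
# The cube ↔ ball radial maps of `ℝ³` (sup-norm rescaling) and their Lipschitz bounds

`linf x = max_i |x_i|`; `toBall x = (linf x / ‖x‖) • x` maps the cube `[-s,s]³` onto the Euclidean ball of radius `s`
(`‖toBall x‖ = linf x`), `toCube y = (‖y‖ / linf y) • y` is its inverse (`linf (toCube y) = ‖y‖`); both are globally Lipschitz
(constants `3` and `8`, crude).  Used to transplant the grid Poincaré inequality from a cube to a ball window.
-/

open Finset
open scoped BigOperators

namespace Summit.AtomisticToContinuum.Crystallization.Theorems.ChartedZeroExcessLayeredLatticeLiouvilleWindowPoincare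

/-- the sup norm `max_i |x_i|` on `ℝ³`. -/
noncomputable def linf (x : EuclideanSpace ℝ (Fin 3)) : ℝ := max |x 0| (max |x 1| |x 2|)

/-- the sup norm is nonnegative. [folklore] -/
theorem linf_nonneg (x : EuclideanSpace ℝ (Fin 3)) : 0 ≤ linf x := le_max_of_le_left (abs_nonneg _)

/-- each coordinate is bounded by the sup norm. [folklore] -/
theorem abs_apply_le_linf (x : EuclideanSpace ℝ (Fin 3)) (i : Fin 3) : |x i| ≤ linf x := by
  unfold linf
  fin_cases i
  · exact le_max_left _ _
  · exact le_max_of_le_right (le_max_left _ _)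
  · exact le_max_of_le_right (le_max_right _ _)

/-- `‖x‖∞ ≤ ‖x‖₂`. [folklore] -/
theorem linf_le_norm (x : EuclideanSpace ℝ (Fin 3)) : linf x ≤ ‖x‖ := by
  have h : ∀ i : Fin 3, |x i| ≤ ‖x‖ := fun i => by simpa only [Real.norm_eq_abs] using PiLp.norm_apply_le x i
  exact max_le (h 0) (max_le (h 1) (h 2))

/-- `‖x‖₂ ≤ 2‖x‖∞` (crude form of `√3`). [folklore] -/
theorem norm_le_two_linf (x : EuclideanSpace ℝ (Fin 3)) : ‖x‖ ≤ 2 * linf x := by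
  have h0 := abs_apply_le_linf x 0
  have h1 := abs_apply_le_linf x 1
  have h2 := abs_apply_le_linf x 2
  have hl := linf_nonneg x
  have hsq : ‖x‖ ^ 2 ≤ (2 * linf x) ^ 2 := by
    rw [Literature.Algebra.EuclideanLattices.norm_sq_fin_three]
    have e0 : x 0 ^ 2 = |x 0| ^ 2 := (sq_abs _).symm
    have e1 : x 1 ^ 2 = |x 1| ^ 2 := (sq_abs _).symm
    have e2 : x 2 ^ 2 = |x 2| ^ 2 := (sq_abs _).symm
    rw [e0, e1, e2]
    nlinarith [abs_nonneg (x 0), abs_nonneg (x 1), abs_nonneg (x 2)]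
  exact (pow_le_pow_iff_left₀ (norm_nonneg _) (by positivity) two_ne_zero).1 hsq

/-- the sup norm vanishes only at `0`. [folklore] -/
theorem linf_eq_zero_iff (x : EuclideanSpace ℝ (Fin 3)) : linf x = 0 ↔ x = 0 := by
  constructor
  · intro h
    have := norm_le_two_linf x
    rw [h, mul_zero] at this
    exact norm_le_zero_iff.1 this
  · rintro rfl
    simp [linf]

/-- the sup norm is absolutely homogeneous. [folklore] -/
theorem linf_smul (c : ℝ) (x : EuclideanSpace ℝ (Fin 3)) : linf (c • x) = |c| * linf x := by
  unfold linf
  simp only [PiLp.smul_apply, smul_eq_mul, abs_mul]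
  rw [mul_max_of_nonneg _ _ (abs_nonneg c), mul_max_of_nonneg _ _ (abs_nonneg c)]

/-- triangle inequality for the sup norm. [folklore] -/
theorem linf_sub_le (x y : EuclideanSpace ℝ (Fin 3)) : linf x ≤ linf y + linf (x - y) := by
  have h : ∀ i : Fin 3, |x i| ≤ linf y + linf (x - y) := fun i => by
    calc |x i| = |y i + (x - y) i| := by simp
      _ ≤ |y i| + |(x - y) i| := abs_add_le _ _
      _ ≤ linf y + linf (x - y) := add_le_add (abs_apply_le_linf y i) (abs_apply_le_linf (x - y) i)
  exact max_le (h 0) (max_le (h 1) (h 2))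

/-- the sup norm is `1`-Lipschitz for the Euclidean distance. [folklore] -/
theorem abs_linf_sub_linf_le (x y : EuclideanSpace ℝ (Fin 3)) : |linf x - linf y| ≤ ‖x - y‖ := by
  rw [abs_sub_le_iff]
  constructor
  · have := linf_sub_le x y
    linarith [linf_le_norm (x - y)]
  · have := linf_sub_le y x
    rw [← norm_neg, neg_sub] 
    linarith [linf_le_norm (y - x)]

/-- the cube → ball radial map. -/
noncomputable def toBall (x : EuclideanSpace ℝ (Fin 3)) : EuclideanSpace ℝ (Fin 3) := (linf x / ‖x‖) • x

/-- the ball → cube radial map. -/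
noncomputable def toCube (y : EuclideanSpace ℝ (Fin 3)) : EuclideanSpace ℝ (Fin 3) := (‖y‖ / linf y) • y

/-- `‖toBall x‖₂ = ‖x‖∞`: the cube of half-side `s` goes to the ball of radius `s`. [folklore] -/
theorem norm_toBall (x : EuclideanSpace ℝ (Fin 3)) : ‖toBall x‖ = linf x := by
  by_cases hx : x = 0
  · subst hx; simp [toBall, linf]
  · rw [toBall, norm_smul, Real.norm_eq_abs, abs_of_nonneg (div_nonneg (linf_nonneg x) (norm_nonneg x)),
      div_mul_cancel₀ _ (norm_ne_zero_iff.2 hx)]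

/-- `‖toCube y‖∞ = ‖y‖₂`: the ball of radius `s` goes to the cube of half-side `s`. [folklore] -/
theorem linf_toCube (y : EuclideanSpace ℝ (Fin 3)) : linf (toCube y) = ‖y‖ := by
  by_cases hy : y = 0
  · subst hy; simp [toCube, linf]
  · have hl : linf y ≠ 0 := fun h => hy ((linf_eq_zero_iff y).1 h)
    rw [toCube, linf_smul, abs_of_nonneg (div_nonneg (norm_nonneg y) (linf_nonneg y)), div_mul_cancel₀ _ hl]

/-- `toBall ∘ toCube = id`. [folklore] -/
theorem toBall_toCube (y : EuclideanSpace ℝ (Fin 3)) : toBall (toCube y) = y := by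
  by_cases hy : y = 0
  · subst hy; simp [toBall, toCube]
  · have hl : linf y ≠ 0 := fun h => hy ((linf_eq_zero_iff y).1 h)
    have hn : ‖y‖ ≠ 0 := norm_ne_zero_iff.2 hy
    have h1 : linf (toCube y) = ‖y‖ := linf_toCube y
    have h2 : ‖toCube y‖ = ‖y‖ / linf y * ‖y‖ := by
      rw [toCube, norm_smul, Real.norm_eq_abs, abs_of_nonneg (div_nonneg (norm_nonneg y) (linf_nonneg y))]
    rw [toBall, h1, h2, toCube, smul_smul]
    have : ‖y‖ / (‖y‖ / linf y * ‖y‖) * (‖y‖ / linf y) = 1 := by field_simp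
    rw [this, one_smul]

/-- `toCube ∘ toBall = id`. [folklore] -/
theorem toCube_toBall (x : EuclideanSpace ℝ (Fin 3)) : toCube (toBall x) = x := by
  by_cases hx : x = 0
  · subst hx; simp [toBall, toCube]
  · have hl : linf x ≠ 0 := fun h => hx ((linf_eq_zero_iff x).1 h)
    have hn : ‖x‖ ≠ 0 := norm_ne_zero_iff.2 hx
    have h1 : ‖toBall x‖ = linf x := norm_toBall x
    have h2 : linf (toBall x) = linf x / ‖x‖ * linf x := by
      rw [toBall, linf_smul, abs_of_nonneg (div_nonneg (linf_nonneg x) (norm_nonneg x))]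
    rw [toCube, h1, h2, toBall, smul_smul]
    have : linf x / (linf x / ‖x‖ * linf x) * (linf x / ‖x‖) = 1 := by field_simp
    rw [this, one_smul]

/-- `toBall` is `3`-Lipschitz. [folklore] -/
theorem norm_toBall_sub_le (x y : EuclideanSpace ℝ (Fin 3)) : ‖toBall x - toBall y‖ ≤ 3 * ‖x - y‖ := by
  by_cases hx : x = 0
  · subst hx
    have : toBall (0 : EuclideanSpace ℝ (Fin 3)) = 0 := by simp [toBall]
    rw [this, zero_sub, norm_neg, norm_toBall, zero_sub, norm_neg]
    linarith [linf_le_norm y, norm_nonneg y]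
  by_cases hy : y = 0
  · subst hy
    have : toBall (0 : EuclideanSpace ℝ (Fin 3)) = 0 := by simp [toBall]
    rw [this, sub_zero, norm_toBall, sub_zero]
    linarith [linf_le_norm x, norm_nonneg x]
  have hxn : 0 < ‖x‖ := norm_pos_iff.2 hx
  have hyn : 0 < ‖y‖ := norm_pos_iff.2 hy
  set a := linf x / ‖x‖ with ha
  set a' := linf y / ‖y‖ with ha'
  have ha1 : |a| ≤ 1 := by
    rw [ha, abs_of_nonneg (div_nonneg (linf_nonneg x) hxn.le), div_le_one hxn]
    exact linf_le_norm x
  have hdec : toBall x - toBall y = a • (x - y) + (a - a') • y := by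
    simp only [toBall, smul_sub, sub_smul, ← ha, ← ha']; abel
  have hkey : |a - a'| * ‖y‖ ≤ 2 * ‖x - y‖ := by
    have e : (a - a') * ‖y‖ = (linf x * ‖y‖ - linf y * ‖x‖) / ‖x‖ := by
      rw [ha, ha']; field_simp
    have hnum : |linf x * ‖y‖ - linf y * ‖x‖| ≤ 2 * ‖x‖ * ‖x - y‖ := by
      have e2 : linf x * ‖y‖ - linf y * ‖x‖ = linf x * (‖y‖ - ‖x‖) + ‖x‖ * (linf x - linf y) := by ring
      rw [e2]
      calc |linf x * (‖y‖ - ‖x‖) + ‖x‖ * (linf x - linf y)|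
          ≤ |linf x * (‖y‖ - ‖x‖)| + |‖x‖ * (linf x - linf y)| := abs_add_le _ _
        _ = linf x * |‖y‖ - ‖x‖| + ‖x‖ * |linf x - linf y| := by
            rw [abs_mul, abs_mul, abs_of_nonneg (linf_nonneg x), abs_of_nonneg hxn.le]
        _ ≤ ‖x‖ * ‖x - y‖ + ‖x‖ * ‖x - y‖ := by
            gcongr
            · exact linf_le_norm x
            · rw [abs_sub_comm]; exact abs_norm_sub_norm_le x y
            · exact abs_linf_sub_linf_le x y
        _ = 2 * ‖x‖ * ‖x - y‖ := by ring
    have h3 : |a - a'| * ‖y‖ = |linf x * ‖y‖ - linf y * ‖x‖| / ‖x‖ := by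
      calc |a - a'| * ‖y‖ = |(a - a') * ‖y‖| := by rw [abs_mul, abs_of_nonneg hyn.le]
        _ = |(linf x * ‖y‖ - linf y * ‖x‖) / ‖x‖| := by rw [e]
        _ = |linf x * ‖y‖ - linf y * ‖x‖| / ‖x‖ := by rw [abs_div, abs_of_nonneg hxn.le]
    rw [h3, div_le_iff₀ hxn]
    linarith
  calc ‖toBall x - toBall y‖ = ‖a • (x - y) + (a - a') • y‖ := by rw [hdec]
    _ ≤ ‖a • (x - y)‖ + ‖(a - a') • y‖ := norm_add_le _ _
    _ = |a| * ‖x - y‖ + |a - a'| * ‖y‖ := by rw [norm_smul, norm_smul, Real.norm_eq_abs, Real.norm_eq_abs]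
    _ ≤ 1 * ‖x - y‖ + 2 * ‖x - y‖ := by gcongr
    _ = 3 * ‖x - y‖ := by ring

/-- `toCube` is `8`-Lipschitz. [folklore] -/
theorem norm_toCube_sub_le (x y : EuclideanSpace ℝ (Fin 3)) : ‖toCube x - toCube y‖ ≤ 8 * ‖x - y‖ := by
  by_cases hx : x = 0
  · subst hx
    have : toCube (0 : EuclideanSpace ℝ (Fin 3)) = 0 := by simp [toCube]
    rw [this, zero_sub, norm_neg, zero_sub, norm_neg]
    calc ‖toCube y‖ ≤ 2 * linf (toCube y) := norm_le_two_linf _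
      _ = 2 * ‖y‖ := by rw [linf_toCube]
      _ ≤ 8 * ‖y‖ := by linarith [norm_nonneg y]
  by_cases hy : y = 0
  · subst hy
    have : toCube (0 : EuclideanSpace ℝ (Fin 3)) = 0 := by simp [toCube]
    rw [this, sub_zero, sub_zero]
    calc ‖toCube x‖ ≤ 2 * linf (toCube x) := norm_le_two_linf _
      _ = 2 * ‖x‖ := by rw [linf_toCube]
      _ ≤ 8 * ‖x‖ := by linarith [norm_nonneg x]
  have hxl : 0 < linf x := lt_of_le_of_ne (linf_nonneg x) (fun h => hx ((linf_eq_zero_iff x).1 h.symm))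
  have hyl : 0 < linf y := lt_of_le_of_ne (linf_nonneg y) (fun h => hy ((linf_eq_zero_iff y).1 h.symm))
  set b := ‖x‖ / linf x with hb
  set b' := ‖y‖ / linf y with hb'
  have hb2 : |b| ≤ 2 := by
    rw [hb, abs_of_nonneg (div_nonneg (norm_nonneg x) hxl.le), div_le_iff₀ hxl]
    exact norm_le_two_linf x
  have hdec : toCube x - toCube y = b • (x - y) + (b - b') • y := by
    simp only [toCube, smul_sub, sub_smul, ← hb, ← hb']; abel
  have hkey : |b - b'| * ‖y‖ ≤ 6 * ‖x - y‖ := by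
    have e : (b - b') * ‖y‖ = (‖x‖ * linf y - ‖y‖ * linf x) * ‖y‖ / (linf x * linf y) := by
      rw [hb, hb']; field_simp
    have hnum : |‖x‖ * linf y - ‖y‖ * linf x| ≤ 3 * linf x * ‖x - y‖ := by
      have e2 : ‖x‖ * linf y - ‖y‖ * linf x = ‖x‖ * (linf y - linf x) + linf x * (‖x‖ - ‖y‖) := by ring
      rw [e2]
      calc |‖x‖ * (linf y - linf x) + linf x * (‖x‖ - ‖y‖)|
          ≤ |‖x‖ * (linf y - linf x)| + |linf x * (‖x‖ - ‖y‖)| := abs_add_le _ _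
        _ = ‖x‖ * |linf y - linf x| + linf x * |‖x‖ - ‖y‖| := by
            rw [abs_mul, abs_mul, abs_of_nonneg (norm_nonneg x), abs_of_nonneg hxl.le]
        _ ≤ (2 * linf x) * ‖x - y‖ + linf x * ‖x - y‖ := by
            gcongr
            · exact norm_le_two_linf x
            · rw [abs_sub_comm]; exact abs_linf_sub_linf_le x y
            · exact abs_norm_sub_norm_le x y
        _ = 3 * linf x * ‖x - y‖ := by ring
    have h3 : |b - b'| * ‖y‖ = |‖x‖ * linf y - ‖y‖ * linf x| * ‖y‖ / (linf x * linf y) := by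
      calc |b - b'| * ‖y‖ = |(b - b') * ‖y‖| := by rw [abs_mul, abs_of_nonneg (norm_nonneg y)]
        _ = |(‖x‖ * linf y - ‖y‖ * linf x) * ‖y‖ / (linf x * linf y)| := by rw [e]
        _ = |‖x‖ * linf y - ‖y‖ * linf x| * ‖y‖ / (linf x * linf y) := by
            rw [abs_div, abs_mul, abs_of_nonneg (norm_nonneg y), abs_of_nonneg (mul_nonneg hxl.le hyl.le)]
    rw [h3, div_le_iff₀ (mul_pos hxl hyl)]
    have hy2 : ‖y‖ ≤ 2 * linf y := norm_le_two_linf y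
    calc |‖x‖ * linf y - ‖y‖ * linf x| * ‖y‖ ≤ (3 * linf x * ‖x - y‖) * (2 * linf y) := by
          gcongr
      _ = 6 * ‖x - y‖ * (linf x * linf y) := by ring
  calc ‖toCube x - toCube y‖ = ‖b • (x - y) + (b - b') • y‖ := by rw [hdec]
    _ ≤ ‖b • (x - y)‖ + ‖(b - b') • y‖ := norm_add_le _ _
    _ = |b| * ‖x - y‖ + |b - b'| * ‖y‖ := by rw [norm_smul, norm_smul, Real.norm_eq_abs, Real.norm_eq_abs]
    _ ≤ 2 * ‖x - y‖ + 6 * ‖x - y‖ := by gcongr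
    _ = 8 * ‖x - y‖ := by ring

end Summit.AtomisticToContinuum.Crystallization.Theorems.ChartedZeroExcessLayeredLatticeLiouvilleWindowPoincare
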